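import Summits.BirchSwinnertonDyer.BirchSwinnertonDyer.Theorems.ThetaPartnerAtTwoSignedKatoUpToAtTwoKatoBKTransport
import Summits.BirchSwinnertonDyer.BirchSwinnertonDyer.Theorems.ThetaPartnerAtTwoSignedKatoUpToAtTwoCyclotomicPadicEmbedding
import Literature.NumberTheory.GaloisRepresentations.AbsGaloisGroup
import HarnessLib

/-!
# Route `ThetaPartnerAtTwo` / `ResidualThetaTransportAtTwo`, crux K3 `SignedKatoDivisibilityUpToAtTwo` (stmt-BirchSwinnertonDyer-20308),
# line `colemanrat` v16 — the CYCLOTOMIC-FRAME ENGINE for the `2`-adic frames of the named fact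
# `Kato2004.exists_eulerSystem_expStar_tatePairing_values_two` (p640688): `Γ_{ℚ₂}` acts TRANSITIVELY on the coherent towers
# `e_k : ℚ(ζ_{2^k}) → ℚ̄₂` (one `ψ` for ALL levels), with the open-stabiliser / closed-level-set lemmas it rests on

Width seat `bsd-wall-tp2-p2x-w2` g11 (cell `bsd-wall`), `--supports stmt-BirchSwinnertonDyer-20308 --as helper` (closes nothing). Context:
the fact p640688 quantifies over EVERY continuous frame `Φ : ℚ̄₂ ≃ \overline{ℚ_v}` over `φ : ℚ₂ ≅ ℚ_v` and EVERY coherent tower `e`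
(`e_{k+1}(ζ_{2^{k+1}})² = e_k(ζ_{2^k})`, with level-wise Galois lifts `τ`); print (Kato Thm. 12.5 (1); Rubin 1998 §5 (2)) fixes ONE frame.
The leads' audits `Cruxes/SignedKatoDivisibilityUpToAtTwo/G9-LEAD-AUDIT.md` §4 (Steps A–C) and `G10-LEAD-CLOSEOUT.md` §2 derive on paper
that the ∀-frame quantification is print; G9 §4 Step B uses «two coherent towers into `ℚ̄₂` differ by ONE `u ∈ ℤ₂ˣ`, realised by ONE
`ψ_u ∈ Γ_{ℚ₂}` for the whole tower (the level-wise lifts `τ_k` do not suffice)» and lists that as kernel infrastructure not in the tree.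
This file proves it, choice-free (no `2`-adic unit is constructed):

* `isOpen_stabilizer` — point stabilisers of `Γ_{ℚ₂} ↷ ℚ̄₂` are open (Krull topology; `IntermediateField.fixingSubgroup_isOpen`);
* `isClosed_setOf_smul_eq` — `{ψ ∈ Γ_{ℚ₂} | ψ • x = y}` is closed (empty or a coset of the open, hence closed, stabiliser);
* `exists_absGal_smul_tower_eq` — **for two coherent towers `e, e'` there is ONE `ψ ∈ Γ_{ℚ₂}` with `ψ • e'_k(w) = e_k(w)` for all `k, w`**:
  level-wise `Φ_{2^k}` is irreducible over `ℚ₂` (tree `SignedTwist.irreducible_cyclotomic_prime_pow_padic`,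
  `RootOfUnityAction.exists_smul_eq_pow_and_smul_eq_self`), the level sets are non-empty, closed and DECREASING by coherence, and `Γ_{ℚ₂}` is
  compact (`Field.absoluteGaloisGroup.instCompactSpace`) — Cantor's intersection theorem; an embedding of `ℚ(ζ_{2^k})` is determined by `ζ_{2^k}`
  (`KatoValue.ringHom_ext_zeta`);
* `exists_absGal_smul_tower_eq_zeta` — every coherent tower is carried by some `ψ` onto the tree's own tower `PadicCyclotomicTower.zeta 2`
  (the frame the line's consumer `KatoBK.coreKZ_of_coreKZLit` builds via `KatoBK.exists_algHom_cyclotomicField_zeta_eq`).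

Companions already in the tree (cited, not restated): Step A bricks of width seat w3 g11, `SignedKatoOffTwo.FrameChange.padicRingEquiv_eq`
(`Aut(ℚ_p) = 1`, equivalence form, from `AbsTopIII.padicRingHom_self_eq_id`), `FrameChange.exists_gal_frameChange`, `FrameChange.gal_smul_tsum`,
`FrameChange.valuation_gal_smul`, `FrameChange.zCoord_map` (`Theorems/ThetaPartnerAtTwoSignedKatoUpToAtTwoFrameRigidity.lean`); the LOCAL
cyclotomic character is onto, `SignedTwist.cyclotomicCharacter_padic_surjective`, with `LocalVar.smul_zeta_eq_pow` and
`LocalVar.smul_eq_smul_of_smul_zeta_eq` (`…LocalCyclotomicVariable.lean`); the transport `Γ_{ℚ₂} → Γ_v`, `SignedEC.transportAut_model_apply`.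

HONEST FRAMING: helper lemmas (topological group theory of `Γ_{ℚ₂}` on roots of unity); they prove no stub and do not touch the registered
skeleton; the «F∃ ⟹ F∀» restatement of p640688 is NOT built here and is NOT recommended by the lead (G10 §2: it buys no robustness); these
lemmas stand on their own as frame infrastructure. K3/K3P′ stay conditional on the named facts; BSD is not proved by any of this.
-/

set_option autoImplicit false
-- the Theorems namespace of this sub repeats the summit name by design (D-0017 nested layout)
set_option linter.dupNamespace false

noncomputable section

set_option backward.isDefEq.respectTransparency false

open scoped NumberField
open Polynomial Field
open Literature.NumberTheory.GaloisRepresentations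
open Literature.NumberTheory.EllipticCurves.Kato2004.EulerSystemValues
open Summit.BirchSwinnertonDyer.Rank1Residual.Additive

namespace Summit.BirchSwinnertonDyer.BirchSwinnertonDyer.Theorems.SignedKatoOffTwo.FrameTransport

/-! ## §B The cyclotomic frame: `Γ_{ℚ₂}` acts transitively on coherent towers `e_k : ℚ(ζ_{2^k}) → ℚ̄₂` -/

section StepB

/-- **Point stabilisers of `Γ_{ℚ₂} ↷ ℚ̄₂` are open** in the Krull topology (they contain the fixing subgroup of the finite extension
`ℚ₂(x)`, which is open, `IntermediateField.fixingSubgroup_isOpen`). [cite: NeukirchANT1999, Ch. IV (1.1)] [folklore] -/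
theorem isOpen_stabilizer (x : PadicAlgCl 2) :
    IsOpen ((MulAction.stabilizer (Field.absoluteGaloisGroup ℚ_[2]) x : Subgroup (Field.absoluteGaloisGroup ℚ_[2])) :
      Set (Field.absoluteGaloisGroup ℚ_[2])) := by
  haveI : FiniteDimensional ℚ_[2] (IntermediateField.adjoin ℚ_[2] ({x} : Set (PadicAlgCl 2))) :=
    IntermediateField.adjoin.finiteDimensional (Algebra.IsAlgebraic.isAlgebraic x).isIntegral
  refine Subgroup.isOpen_mono ?_ (IntermediateField.fixingSubgroup_isOpen (IntermediateField.adjoin ℚ_[2] ({x} : Set (PadicAlgCl 2))))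
  intro σ hσ
  exact (IntermediateField.mem_fixingSubgroup_iff _ _).mp hσ x
    (IntermediateField.subset_adjoin ℚ_[2] ({x} : Set (PadicAlgCl 2)) (Set.mem_singleton x))

/-- **`{ψ ∈ Γ_{ℚ₂} | ψ • x = y}` is closed** (empty, or a left coset of the open — hence closed — stabiliser of `x`).
[cite: NeukirchANT1999, Ch. IV (1.1)] [folklore] -/
theorem isClosed_setOf_smul_eq (x y : PadicAlgCl 2) :
    IsClosed {ψ : Field.absoluteGaloisGroup ℚ_[2] | ψ • x = y} := by
  by_cases h : ∃ ρ : Field.absoluteGaloisGroup ℚ_[2], ρ • x = y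
  · obtain ⟨ρ, hρ⟩ := h
    have hH : IsClosed ((MulAction.stabilizer (Field.absoluteGaloisGroup ℚ_[2]) x :
        Subgroup (Field.absoluteGaloisGroup ℚ_[2])) : Set (Field.absoluteGaloisGroup ℚ_[2])) :=
      Subgroup.isClosed_of_isOpen _ (isOpen_stabilizer x)
    have hS : {ψ : Field.absoluteGaloisGroup ℚ_[2] | ψ • x = y} =
        (fun ψ ↦ ρ⁻¹ * ψ) ⁻¹' ((MulAction.stabilizer (Field.absoluteGaloisGroup ℚ_[2]) x :
          Subgroup (Field.absoluteGaloisGroup ℚ_[2])) : Set (Field.absoluteGaloisGroup ℚ_[2])) := by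
      ext ψ
      simp only [Set.mem_setOf_eq, Set.mem_preimage, SetLike.mem_coe, MulAction.mem_stabilizer_iff, mul_smul]
      constructor
      · intro hψ
        rw [hψ, ← hρ, inv_smul_smul]
      · intro hψ
        have h2 := congrArg (fun z ↦ ρ • z) hψ
        simp only [smul_inv_smul] at h2
        rw [h2, hρ]
    rw [hS]
    exact hH.preimage (continuous_const_mul ρ⁻¹)
  · have hS : {ψ : Field.absoluteGaloisGroup ℚ_[2] | ψ • x = y} = ∅ :=
      Set.eq_empty_iff_forall_notMem.mpr fun ψ hψ ↦ h ⟨ψ, hψ⟩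
    rw [hS]
    exact isClosed_empty

/-- **`Γ_{ℚ₂}` acts transitively on coherent `2`-adic cyclotomic frames.** Let `e, e' : ℚ(ζ_{2^k}) → ℚ̄₂` (`k ≥ 0`, Kato's value fields
`CyclotomicField (cycLevel 2 k ∅) ℚ`) be two COHERENT towers of embeddings, `e_{k+1}(ζ_{2^{k+1}})² = e_k(ζ_{2^k})` and likewise for `e'`.
Then ONE `ψ ∈ Γ_{ℚ₂}` carries `e'` to `e` at every level: `ψ • e'_k(w) = e_k(w)` for all `k` and all `w`. Proof: at level `k`,
`e_k(ζ)` and `e'_k(ζ)` are primitive `2^k`-th roots of unity in `ℚ̄₂`, so `e_k(ζ) = e'_k(ζ)^{a_k}` with `a_k` a unit, and some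
`ρ_k ∈ Γ_{ℚ₂}` raises all `2^k`-th roots of unity to the `a_k`-th power (`Φ_{2^k}` is irreducible over `ℚ₂`,
`SignedTwist.irreducible_cyclotomic_prime_pow_padic`, `RootOfUnityAction.exists_smul_eq_pow_and_smul_eq_self`); the sets
`S_k = {ψ | ψ • e'_k(ζ) = e_k(ζ)}` are therefore non-empty, closed (`isClosed_setOf_smul_eq`), and DECREASING by coherence, so they have
a common point by compactness of `Γ_{ℚ₂}` (Cantor); finally an embedding of `ℚ(ζ_{2^k})` is determined by the image of `ζ_{2^k}`
(`KatoValue.ringHom_ext_zeta`). Step B engine of the frame transport («two coherent towers differ by one `u ∈ ℤ₂ˣ`, realised by one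
`ψ_u`»). [cite: SerreLocalFields1979, Ch. IV §4, Prop. 17] [cite: NeukirchANT1999, Ch. II (7.13), Ch. IV (1.1)] [folklore] -/
theorem exists_absGal_smul_tower_eq
    (e e' : ∀ k : ℕ, CyclotomicField (cycLevel 2 k ∅) ℚ →ₐ[ℚ] PadicAlgCl 2)
    (he : ∀ k : ℕ, e (k + 1) (IsCyclotomicExtension.zeta (cycLevel 2 (k + 1) ∅) ℚ (CyclotomicField (cycLevel 2 (k + 1) ∅) ℚ)) ^ 2 =
      e k (IsCyclotomicExtension.zeta (cycLevel 2 k ∅) ℚ (CyclotomicField (cycLevel 2 k ∅) ℚ)))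
    (he' : ∀ k : ℕ, e' (k + 1) (IsCyclotomicExtension.zeta (cycLevel 2 (k + 1) ∅) ℚ (CyclotomicField (cycLevel 2 (k + 1) ∅) ℚ)) ^ 2 =
      e' k (IsCyclotomicExtension.zeta (cycLevel 2 k ∅) ℚ (CyclotomicField (cycLevel 2 k ∅) ℚ))) :
    ∃ ψ : Field.absoluteGaloisGroup ℚ_[2], ∀ (k : ℕ) (w : CyclotomicField (cycLevel 2 k ∅) ℚ), ψ • e' k w = e k w := by
  classical
  -- the generators and their images
  set Z : ∀ k : ℕ, CyclotomicField (cycLevel 2 k ∅) ℚ :=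
    fun k ↦ IsCyclotomicExtension.zeta (cycLevel 2 k ∅) ℚ (CyclotomicField (cycLevel 2 k ∅) ℚ) with hZ
  have hprim : ∀ k, IsPrimitiveRoot (e k (Z k)) (cycLevel 2 k ∅) := fun k ↦
    (IsCyclotomicExtension.zeta_spec (cycLevel 2 k ∅) ℚ (CyclotomicField (cycLevel 2 k ∅) ℚ)).map_of_injective
      (e k).toRingHom.injective
  have hprim' : ∀ k, IsPrimitiveRoot (e' k (Z k)) (cycLevel 2 k ∅) := fun k ↦
    (IsCyclotomicExtension.zeta_spec (cycLevel 2 k ∅) ℚ (CyclotomicField (cycLevel 2 k ∅) ℚ)).map_of_injective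
      (e' k).toRingHom.injective
  -- the level conditions
  let S : ℕ → Set (Field.absoluteGaloisGroup ℚ_[2]) := fun k ↦ {ψ | ψ • e' k (Z k) = e k (Z k)}
  have hne : ∀ k, (S k).Nonempty := by
    intro k
    obtain ⟨i, hi, hiη⟩ := (hprim' k).eq_pow_of_pow_eq_one ((hprim k).pow_eq_one)
    have hcop : i.Coprime (cycLevel 2 k ∅) :=
      ((hprim' k).pow_iff_coprime (NeZero.pos _) i).mp (hiη ▸ hprim k)
    have hirr : Irreducible (cyclotomic (cycLevel 2 k ∅ * 1) ℚ_[2]) := by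
      rw [mul_one, KatoBK.cycLevel_two_empty]
      exact SignedTwist.irreducible_cyclotomic_prime_pow_padic 2 k
    obtain ⟨ρ, hρ, -⟩ := RootOfUnityAction.exists_smul_eq_pow_and_smul_eq_self (K := ℚ_[2]) (B := 1)
      (Nat.coprime_one_right _) hirr (ZMod.unitOfCoprime i hcop)
    refine ⟨ρ, ?_⟩
    change ρ • e' k (Z k) = e k (Z k)
    rw [hρ _ ((hprim' k).pow_eq_one), ZMod.coe_unitOfCoprime, ZMod.val_natCast, Nat.mod_eq_of_lt hi, hiη]
  have hcl : ∀ k, IsClosed (S k) := fun k ↦ isClosed_setOf_smul_eq _ _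
  have hmono : ∀ k, S (k + 1) ⊆ S k := by
    intro k ψ hψ
    change ψ • e' (k + 1) (Z (k + 1)) = e (k + 1) (Z (k + 1)) at hψ
    change ψ • e' k (Z k) = e k (Z k)
    rw [← he' k, smul_pow', hψ, he k]
  obtain ⟨ψ, hψ⟩ :=
    IsCompact.nonempty_iInter_of_sequence_nonempty_isCompact_isClosed S hmono hne (hcl 0).isCompact hcl
  refine ⟨ψ, fun k ↦ ?_⟩
  have hk : ψ • e' k (Z k) = e k (Z k) := Set.mem_iInter.mp hψ k
  -- two embeddings of `ℚ(ζ_{2^k})` agreeing on `ζ`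
  have hext := KatoValue.ringHom_ext_zeta
    (((Field.absoluteGaloisGroup.toAlgEquiv ℚ_[2] ψ).toRingEquiv.toRingHom).comp (e' k).toRingHom) (e k).toRingHom
    (by simpa [Field.absoluteGaloisGroup.smul_def] using hk)
  intro w
  have hw := RingHom.congr_fun hext w
  simpa [Field.absoluteGaloisGroup.smul_def] using hw

/-- **The tree's own tower is reached from any coherent frame**: for every coherent tower `e'` there is `ψ ∈ Γ_{ℚ₂}` with
`ψ • e'_k(ζ_{2^k}) = zeta 2 k` for all `k` (`zeta 2` = `PadicCyclotomicTower.zeta 2`, the compatible system used by the line's consumer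
`KatoBK.coreKZ_of_coreKZLit`; its frame `KatoBK.exists_algHom_cyclotomicField_zeta_eq` is coherent by `zeta_succ_pow`).
[cite: SerreLocalFields1979, Ch. IV §4, Prop. 17] [folklore] -/
theorem exists_absGal_smul_tower_eq_zeta
    (e' : ∀ k : ℕ, CyclotomicField (cycLevel 2 k ∅) ℚ →ₐ[ℚ] PadicAlgCl 2)
    (he' : ∀ k : ℕ, e' (k + 1) (IsCyclotomicExtension.zeta (cycLevel 2 (k + 1) ∅) ℚ (CyclotomicField (cycLevel 2 (k + 1) ∅) ℚ)) ^ 2 =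
      e' k (IsCyclotomicExtension.zeta (cycLevel 2 k ∅) ℚ (CyclotomicField (cycLevel 2 k ∅) ℚ))) :
    ∃ ψ : Field.absoluteGaloisGroup ℚ_[2], ∀ k : ℕ,
      ψ • e' k (IsCyclotomicExtension.zeta (cycLevel 2 k ∅) ℚ (CyclotomicField (cycLevel 2 k ∅) ℚ)) =
        PadicCyclotomicTower.zeta 2 k := by
  obtain ⟨e, he⟩ := KatoBK.exists_algHom_cyclotomicField_zeta_eq
  have hcoh : ∀ k : ℕ, e (k + 1) (IsCyclotomicExtension.zeta (cycLevel 2 (k + 1) ∅) ℚ (CyclotomicField (cycLevel 2 (k + 1) ∅) ℚ)) ^ 2 =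
      e k (IsCyclotomicExtension.zeta (cycLevel 2 k ∅) ℚ (CyclotomicField (cycLevel 2 k ∅) ℚ)) := by
    intro k; rw [he, he]; exact PadicCyclotomicTower.zeta_succ_pow 2 k
  obtain ⟨ψ, hψ⟩ := exists_absGal_smul_tower_eq e e' hcoh he'
  exact ⟨ψ, fun k ↦ by rw [hψ, he]⟩

end StepB

end Summit.BirchSwinnertonDyer.BirchSwinnertonDyer.Theorems.SignedKatoOffTwo.FrameTransport

end
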